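import Literature.MathematicalPhysics.QuantumFieldTheory.Balaban1983to89.B3Op116CollarBoxFaces
import Literature.MathematicalPhysics.QuantumFieldTheory.Balaban1983to89.B3Op116DKernelRegularTorus

/-!
# `Balaban1983to89.B3Op116CellBoxFaceFamily` — T. Bałaban, *(Higgs)₂,₃ quantum fields in a finite volume. III. Renormalization*, Commun. Math. Phys.
# **88** (1983) 411–445 [Balaban1983Higgs3], (2.10) p. 426 / p. 433; part I [Balaban1982Higgs1] Prop. 2.1 p. 611 l.1–2, (3.14) p. 614:
# **PLUMBING FOR THE (C)-LEVEL PLUGS OF THE (1.16)-ON-A-BOX PROGRAMME**: the faces of a cell-product box `□ = cellBox K K₀ S` as a `Fin`-indexed family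
# of level sets covering the legs of the bonds crossing `∂□` (p40 g77's `B3Op116CollarBoxFaces.faces` enumerated), and the `D^ε_B`-column of `G_k(Ω,A+B)`
# in the `𝔪` currency through the split (I.3.14) — route γ′ of GAPS.md G-B3-16.A1, p35 `DESIGN-FILE4.md` §16–§17

statement-level skeleton of published theorems with citation tags; proofs where landed; nothing here is a claim about the Yang–Mills mass gap

PDF held: `paper:balaban1983-higgs-2-3-quantum-fields-finite-volume` (journal page = PDF page + 410; p. 426 = `p0016.txt`, p. 433 = `p0023.txt`);
`paper:balaban1982-cmp85-higgs23-i` (p. 611 = PDF 9, p. 614 = PDF 12).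

CITATION HEADER (lean-in-tree rule).  T. Bałaban, CMP **88** (1983) 411–445 [Balaban1983Higgs3]: (2.6) p. 424, (2.10) p. 426, p. 433; part I, CMP **85**
(1982) 603–636 [Balaban1982Higgs1]: Prop. 2.1 p. 610, p. 611 l.1–2 (boxes of big blocks), (3.14) p. 614.  Cell `lit-balaban` (HOME
`run/shared/lean/pub/lit-balaban/`), Phase-2 proof seat **p35** gen 27 (literature-prover-lit-balaban-p35-g27-0; free-target protocol G.5-34(d), TAKING
HOME/STATUS.md 2026-08-23T16:58:04Z + addendum, cc p40 / r15 / r14 / p33).  SKELETON rows **B3.Eq2.10** / **B3.Txt@433** / **B3.Prop1** (owner r15) —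
located SUPPORT file, no head claim.  USED BY NAME, never restated: p40 g77's `B3Op116CollarBoxFaces.{faces, exists_face_of_mem_exB, exists_face_of_mem_enB}`,
`B3Op116CollarSources.{exB, enB, mem_exB, mem_enB}`, p33's `B1Ineq225RegularBox.cellBox`, r14's `B3Op116KernelRegularTorus.norm_covDeriv_le_add_split`,
p35's `B3Op116DKernelRegularTorus.{cK1}`, `B3Op116MajorantStep.{maj, maj_shift_left, maj_exponent_reduce, mul_maj, maj_add}`, r14's
`B3Ineq210RegularRegion.{Interior, Interior.mem, Interior.shift_mem}`, `B1TorusCubeLocality26.rS`, `B1Ineq234LevelZero.{tdist_shift_le_one,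
tdist_unshift_le_one, tdist_triangle_real}`, p40's `B3Op116CollarBoxFaces.mem_faces`.

WHAT IS PRINTED (verbatim).  p. 433 [PDF 23]: *"We assume that □₁, □ are sums of big blocks of the unit lattice."*  p. 426 (2.10): *"if the propagator
is differentiated, then for each differentiation, there is an additional factor (L^jη)^{−1} on the right side."*  READINGS (not verbatim): [B1] p. 611
l.1–2 — the regions are unions of rectangular parallelepipeds of big blocks (the tree's `cellBox`); [B1] (3.14) p. 614 is the expansion of `U(A)`, of which
the split `D_{A+B} = D_B + M(A)` (r14's `norm_covDeriv_le_add_split`, carrying its own tag) is a reading.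

WHAT THIS FILE PROVES.  §1 `faceFam K K₀ S i` = the `i`-th slice `(ν, r)` of p40's `faces K K₀ S` cut to `□` (enumeration `Finset.equivFin`): each is a
level set (`faceFam_level`), the leaving / entering legs of `exB □ A` / `enB □ A` are covered (`exB_cover_cellBox`, `enB_cover_cellBox`), and a height
condition stated against `faces` transports to the enumeration (`height_faceFam`) — exactly the data `(F, ν, c, hF, hexF, henF, hh)` the (B)-level files
`B3Op116DKernelRegularBox` / `B3Op116HolderKernelRegularBox` take as hypotheses.  §2 `dcol_split_le_maj`: from the (2.10) dictionary of `G_k(Ω,A+B)` on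
`Ω` (values exponent 2, own derivative exponent 1, constant `ε^dC`, rate `0 < δ₁ ≤ 1`) and `sup|A| ≤ s`,
`Σ_i‖(D^ε_BG_k(Ω,A+B)e_{(y,i)})(b)‖ ≤ 𝔪_k(c_{K1}, 1; δ₁)(b₋,y)` at every bond `b ⊂ Ω`, `c_{K1} = ε^dC(1 + e|e|s·L^kε)`.
§3 the `Interior` glue: `tdist_update_le`, `inside_of_interior` (an `Interior k K₀ □` point gives bonds `⊂ □`) and
**`faces_height_of_interior`** (`K₀ ≥ 1`: an `Interior k K₀ □` point is `≥ L^k` lattice units above every face slice of `faces k K₀ S` — the adjacent slice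
is outside `□` and Interior's ball of radius `2r_S + 2L^kK₀(d+1) + 1` is inside): the height hypothesis of the margin theorems with `θ = 1`, i.e. the
bridge from r14's `Interior` (the binder shape of p40's `ineq25At_op116_smooth_of_bounds`) to this programme's face heights.
HONEST SCOPE.  Plumbing only (no estimate of B3 is concluded here); one `def` (`faceFam`); no `def … : Prop`, no new named fact, no `sorry`; axioms standard.
Value = support file of a by-reference step of B3 — NOT summit progress and nothing about the Yang–Mills mass gap.
-/

noncomputable section

open scoped BigOperators

namespace Literature.MathematicalPhysics.QuantumFieldTheory.Balaban1983to89.B3Op116CellBoxFaceFamily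

open HiggsLattice (ChargeData ScalarField covDeriv)
open HiggsCovariance (propagatorK E)
open HiggsCovariancePos (Inside)
open B1Eq230FluctCov (Ix cb)
open B1Ineq225RegularBox (cellBox mem_cellBox)
open B3Op116MajorantStep (maj maj_nonneg maj_rate_mono maj_const_mono maj_add mul_maj maj_shift_left maj_exponent_reduce)
open B3Op116CollarSources (exB enB mem_exB mem_enB)
open B3Op116CollarBoxFaces (faces exists_face_of_mem_exB exists_face_of_mem_enB)
open B3Op116KernelRegularTorus (norm_covDeriv_le_add_split)
open B3Op116DKernelRegularTorus (cK1 cK1_ge)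

variable {P : HiggsLattice.Params} {N : ℕ}

/-! ## §1 The faces of a cell-product box as a `Fin`-indexed family of level sets -/

section Faces

open scoped Classical

variable (K K₀ : ℕ) (S : Fin P.d → Finset ℕ)

/-- **The face family of `□ = cellBox K K₀ S`, enumerated**: face `i` is the level set `{u ∈ □ : u_ν = r}` of the `i`-th slice `(ν, r)` of p40's
`faces K K₀ S` (enumeration `Finset.equivFin`). [cite: Balaban1982Higgs1, Prop. 2.1 p.611 l.1–2] [cite: Balaban1983Higgs3, p.433] -/
def faceFam (i : Fin (faces K K₀ S).card) : Finset (HiggsLattice.Site P 0) :=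
  (cellBox K K₀ S).filter fun u => u ((faces K K₀ S).equivFin.symm i).1.1 = ((faces K K₀ S).equivFin.symm i).1.2

/-- each face is a level set of its coordinate (the `hF` of the face lemmas). [cite: Balaban1982Higgs1, Prop. 2.1 p.611 l.1–2] -/
theorem faceFam_level : ∀ i : Fin (faces K K₀ S).card, ∀ u ∈ faceFam K K₀ S i,
    u ((faces K K₀ S).equivFin.symm i).1.1 = ((faces K K₀ S).equivFin.symm i).1.2 :=
  fun _ _ hu => (Finset.mem_filter.1 hu).2

/-- **the leaving legs are covered**: every bond of `exB □ A` has its initial point on some face. [cite: Balaban1983Higgs3, p.433] [cite: Balaban1982Higgs1, Prop. 2.1 p.611 l.1–2] -/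
theorem exB_cover_cellBox (A : HiggsLattice.VecField P 0) :
    ∀ b ∈ exB (cellBox K K₀ S) A, ∃ i : Fin (faces K K₀ S).card, b.src ∈ faceFam K K₀ S i := by
  intro b hb
  obtain ⟨f, hf, hbf⟩ := exists_face_of_mem_exB (K := K) (K₀ := K₀) S A b hb
  refine ⟨(faces K K₀ S).equivFin ⟨f, hf⟩, Finset.mem_filter.2 ⟨(mem_exB.1 hb).1, ?_⟩⟩
  rw [Equiv.symm_apply_apply]
  exact hbf

/-- **the entering legs are covered**: every bond of `enB □ A` has its final point on some face. [cite: Balaban1983Higgs3, p.433] [cite: Balaban1982Higgs1, Prop. 2.1 p.611 l.1–2] -/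
theorem enB_cover_cellBox (A : HiggsLattice.VecField P 0) :
    ∀ b ∈ enB (cellBox K K₀ S) A, ∃ i : Fin (faces K K₀ S).card, b.tgt ∈ faceFam K K₀ S i := by
  intro b hb
  obtain ⟨f, hf, hbf⟩ := exists_face_of_mem_enB (K := K) (K₀ := K₀) S A b hb
  refine ⟨(faces K K₀ S).equivFin ⟨f, hf⟩, Finset.mem_filter.2 ⟨(mem_enB.1 hb).2.1, ?_⟩⟩
  rw [Equiv.symm_apply_apply]
  exact hbf

/-- the height condition against the face levels, transported to the enumeration. [cite: Balaban1983Higgs3, p.433] -/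
theorem height_faceFam {x : HiggsLattice.Site P 0} {h : ℝ}
    (hh : ∀ f ∈ faces K K₀ S, h ≤ ((min (x f.1 - f.2).val (f.2 - x f.1).val : ℕ) : ℝ)) :
    ∀ i : Fin (faces K K₀ S).card, h ≤ ((min (x ((faces K K₀ S).equivFin.symm i).1.1 - ((faces K K₀ S).equivFin.symm i).1.2).val
      (((faces K K₀ S).equivFin.symm i).1.2 - x ((faces K K₀ S).equivFin.symm i).1.1).val : ℕ) : ℝ) :=
  fun i => hh _ ((faces K K₀ S).equivFin.symm i).2

end Faces

/-! ## §2 The `D^ε_B`-column of `G_k(Ω,A+B)` through the split (I.3.14), in the `𝔪` currency -/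

section Split

variable {C : ChargeData N} {Ω : Finset (HiggsLattice.Site P 0)} {A B : HiggsLattice.VecField P 0} {msq a : ℝ} {k : ℕ} {δ₁ Cst s : ℝ}

/-- **`Σ_i‖(D^ε_BG_k(Ω,A+B)e_{(y,i)})(b)‖ ≤ 𝔪_k(ε^dC(1 + e|e|s·L^kε), 1; δ₁)(b₋,y)`** at a bond `b ⊂ Ω` and `y ∈ Ω`, from the (2.10) dictionary of
`G_k(Ω,A+B)` on `Ω` (its own derivative `D^ε_{A+B}`: exponent 1; its values: exponent 2) and `sup|A| ≤ s`: the split `D^ε_B = D^ε_{A+B} − M`, the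
value column shifted from `b₊` to `b₋` (factor `e`) and one exponent bought with `L^kε` — the torus lemma `B3Op116DKernelRegularTorus.dcol_add_le_maj`
on a region. [cite: Balaban1982Higgs1, (3.14) p.614] [cite: Balaban1983Higgs3, (2.6) p.424, (2.10) p.426] -/
theorem dcol_split_le_maj (hδ₁ : 0 < δ₁) (hδ₁1 : δ₁ ≤ 1) (hCst : 0 ≤ Cst) (hs : 0 ≤ s) (hA : ∀ b : HiggsLattice.PBond P 0, |A b| ≤ s)
    (hcol : ∀ x ∈ Ω, ∀ y ∈ Ω, ∑ i : Ix N, ‖propagatorK C Ω (A + B) msq a k (cb P N 0 (y, i)) x‖ ≤ maj P k (P.mesh 0 ^ P.d * Cst) 2 δ₁ x y)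
    (hdcol : ∀ b : HiggsLattice.PBond P 0, Inside Ω b → ∀ y ∈ Ω,
      ∑ i : Ix N, ‖covDeriv C (A + B) (propagatorK C Ω (A + B) msq a k (cb P N 0 (y, i))) b‖ ≤ maj P k (P.mesh 0 ^ P.d * Cst) 1 δ₁ b.src y)
    (b : HiggsLattice.PBond P 0) (hb : Inside Ω b) (y : HiggsLattice.Site P 0) (hy : y ∈ Ω) :
    ∑ i : Ix N, ‖covDeriv C B (propagatorK C Ω (A + B) msq a k (cb P N 0 (y, i))) b‖ ≤ maj P k (cK1 P C k Cst s) 1 δ₁ b.src y := by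
  have hc : 0 ≤ P.mesh 0 ^ P.d * Cst := mul_nonneg (pow_nonneg (P.mesh_pos 0).le _) hCst
  have hes : 0 ≤ |C.e| * s := mul_nonneg (abs_nonneg _) hs
  have hsplit : ∑ i : Ix N, ‖covDeriv C B (propagatorK C Ω (A + B) msq a k (cb P N 0 (y, i))) b‖
      ≤ ∑ i : Ix N, ‖covDeriv C (A + B) (propagatorK C Ω (A + B) msq a k (cb P N 0 (y, i))) b‖
        + |C.e| * s * ∑ i : Ix N, ‖propagatorK C Ω (A + B) msq a k (cb P N 0 (y, i)) b.tgt‖ := by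
    rw [Finset.mul_sum, ← Finset.sum_add_distrib]
    exact Finset.sum_le_sum fun i _ => norm_covDeriv_le_add_split C A B (hA b) _
  have h2 : ∑ i : Ix N, ‖propagatorK C Ω (A + B) msq a k (cb P N 0 (y, i)) b.tgt‖
      ≤ maj P k (Real.exp 1 * (P.mesh 0 ^ P.d * Cst) * P.mesh k) 1 δ₁ b.src y := by
    refine ((hcol b.tgt hb.2 y hy).trans (maj_shift_left hδ₁ hδ₁1 hc b.src y b.dir)).trans ?_
    have h := maj_exponent_reduce (P := P) (k := k) (a := 2) (δ := δ₁) (mul_nonneg (Real.exp_nonneg 1) hc) b.src y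
    rw [show (2 : ℝ) - 1 = 1 by norm_num] at h
    exact h
  refine hsplit.trans ((add_le_add (hdcol b hb y hy) (mul_le_mul_of_nonneg_left h2 hes)).trans (le_of_eq ?_))
  rw [mul_maj, maj_add, cK1]
  ring_nf

end Split

/-! ## §3 Interior points of a cell-product box: the glue to the `Interior` binders of the (2.5) assembly -/

section InteriorGlue

open B3Ineq210RegularRegion (Interior)
open B1TorusCubeLocality26 (rS)
open B1TorusCubeCover (half)
open B1Ineq225RegularBox (cellOf)
open B1Ineq234LevelZero (tdist_shift_le_one tdist_unshift_le_one tdist_triangle_real)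
open B3Op116CollarBoxFaces (mem_faces)

variable {k K₀ : ℕ} {S : Fin P.d → Finset ℕ}

/-- the (1.3)-distance from `x` to the site with its `ν`-coordinate replaced by `r` is at most the torus distance of the two coordinates.
[cite: Balaban1982Higgs1, (1.3) p.604] -/
theorem tdist_update_le (x : HiggsLattice.Site P 0) (ν : Fin P.d) (r : ZMod (P.sitesPerDir 0 ν)) :
    HiggsLattice.Site.tdist x (Function.update x ν r) ≤ min (x ν - r).val (r - x ν).val := by
  unfold HiggsLattice.Site.tdist
  refine Finset.sup_le fun μ _ => ?_
  by_cases hμ : μ = ν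
  · subst hμ
    rw [Function.update_self]
  · rw [Function.update_of_ne hμ, sub_self, ZMod.val_zero, min_self]
    exact Nat.zero_le _

/-- an `Interior` point of `□` gives a bond `⟨x, x+εe_μ⟩ ⊂ □`. [cite: Balaban1982Higgs1, Prop. 2.1 p.610] -/
theorem inside_of_interior {x : HiggsLattice.Site P 0} (hx : Interior k K₀ (cellBox k K₀ S) x) (μ : Fin P.d) :
    Inside (cellBox k K₀ S) ⟨x, μ⟩ :=
  ⟨hx.mem, hx.shift_mem μ⟩

/-- **AN INTERIOR POINT OF A CELL-PRODUCT BOX IS ONE TOP BLOCK INSIDE EVERY FACE** (`K₀ ≥ 1`): for every face slice `(ν, r)` of `□ = cellBox k K₀ S`,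
`L^k ≤ min((x_ν − r).val, (r − x_ν).val)` — the slice adjacent to a face slice lies outside `□`, and `Interior`'s ball of radius
`2r_S + 2L^kK₀(d+1) + 1` around `x` lies inside; so the height hypothesis of the margin theorems holds with `θ = 1`.
[cite: Balaban1982Higgs1, Prop. 2.1 p.610, p.611 l.1–2] [cite: Balaban1983Higgs3, p.433] -/
theorem faces_height_of_interior (hK₀ : 1 ≤ K₀) {x : HiggsLattice.Site P 0} (hx : Interior k K₀ (cellBox k K₀ S) x) :
    ∀ f ∈ faces k K₀ S, 1 * (P.L : ℝ) ^ k ≤ ((min (x f.1 - f.2).val (f.2 - x f.1).val : ℕ) : ℝ) := by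
  intro f hf
  obtain ⟨-, hside⟩ := mem_faces.1 hf
  set z : HiggsLattice.Site P 0 := Function.update x f.1 f.2 with hz
  -- a site `y` one step from `z` in direction `ν` whose slice is outside the box is farther than Interior's radius from `x`
  have hfar : ∀ y : HiggsLattice.Site P 0, (y f.1).val / half P k K₀ ∉ S f.1 → HiggsLattice.Site.tdist z y ≤ 1 →
      2 * rS P k K₀ + 2 * half P k K₀ * (P.d + 1) + 1 ≤ min (x f.1 - f.2).val (f.2 - x f.1).val := by
    intro y hyS hzy
    have hy : y ∉ cellBox k K₀ S := fun h => hyS ((mem_cellBox.1 h) f.1)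
    have hxy : ¬ HiggsLattice.Site.tdist x y ≤ 2 * rS P k K₀ + 2 * half P k K₀ * (P.d + 1) + 1 := fun h => hy (hx y h)
    have h1 : HiggsLattice.Site.tdist x y ≤ HiggsLattice.Site.tdist x z + HiggsLattice.Site.tdist z y := by
      exact_mod_cast tdist_triangle_real x z y
    have hxz : HiggsLattice.Site.tdist x z ≤ min (x f.1 - f.2).val (f.2 - x f.1).val := by rw [hz]; exact tdist_update_le x f.1 f.2
    omega
  have hD : 2 * rS P k K₀ + 2 * half P k K₀ * (P.d + 1) + 1 ≤ min (x f.1 - f.2).val (f.2 - x f.1).val := by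
    rcases hside with h | h
    · refine hfar (z.shift f.1) ?_ (tdist_shift_le_one z f.1)
      have e : (z.shift f.1) f.1 = f.2 + 1 := by simp [HiggsLattice.Site.shift, hz]
      rw [e]; exact h
    · refine hfar (z.unshift f.1) ?_ (tdist_unshift_le_one z f.1)
      have e : (z.unshift f.1) f.1 = f.2 - 1 := by simp [HiggsLattice.Site.unshift, hz]
      rw [e]; exact h
  -- `L^k ≤ L^kK₀ = half ≤ Interior's radius`
  have hLk : P.L ^ k ≤ 2 * rS P k K₀ + 2 * half P k K₀ * (P.d + 1) + 1 := by
    have h1 : P.L ^ k ≤ half P k K₀ := by unfold half; exact Nat.le_mul_of_pos_right _ hK₀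
    have h2 : half P k K₀ ≤ 2 * half P k K₀ * (P.d + 1) := by
      have h3 : half P k K₀ * 1 ≤ (2 * half P k K₀) * (P.d + 1) :=
        Nat.mul_le_mul (by omega) (by omega)
      simpa using h3
    omega
  have hfin : ((P.L ^ k : ℕ) : ℝ) ≤ ((min (x f.1 - f.2).val (f.2 - x f.1).val : ℕ) : ℝ) := by exact_mod_cast hLk.trans hD
  simpa [Nat.cast_pow] using hfin

end InteriorGlue

end Literature.MathematicalPhysics.QuantumFieldTheory.Balaban1983to89.B3Op116CellBoxFaceFamily

end
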